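import Summits.BirchSwinnertonDyer.BirchSwinnertonDyer.Theorems.RamifiedHeegnerPairStepLIntrinsicB
import Summits.BirchSwinnertonDyer.BirchSwinnertonDyer.Theorems.RamifiedHeegnerPairStepLIntrinsicC
import Summits.BirchSwinnertonDyer.BirchSwinnertonDyer.Theorems.RamifiedHeegnerPairStepLIntrinsicD
import Summits.BirchSwinnertonDyer.BirchSwinnertonDyer.Theorems.RamifiedHeegnerPairLeafRankOneUpperAtThreeTwistUnit
import Summits.BirchSwinnertonDyer.BirchSwinnertonDyer.Theorems.AdditiveBranchIMCGordTwoRankOneHeegnerKolyvaginGss2RecordsTam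
import Summits.BirchSwinnertonDyer.Rank1Residual.Additive.IntModelTamagawaCertificate
import Literature.NumberTheory.EllipticCurves.IsogenyHasCMIffJMemProofs
import Literature.NumberTheory.EllipticCurves.HeegnerFieldOfDiscriminantProofs
import HarnessLib

/-!
# The TWIST-UNIT datum at the ten intrinsic Gss2 rank-one classes, and U₁ / BSD₃ at the nine Tamagawa-free ones — kernel instances of the twist-unit road

Seat `bsd-trib-w-rhp` g11 (TRIBUNAL-W bc5-witness / kit planner) for route `RamifiedHeegnerPair`; helper file `--supports` the crux U₁
`LeafRankOneUpperAtThree` (stmt-BirchSwinnertonDyer-26022). **HONEST FRAMING: theorems only; per-curve certificates under DISPLAYED inputs;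
nothing is booked, no item is closed; U₁ / TU₁ / L₀ / L₁ stay OPEN class-wide; BSD is not proved for any curve by this file.**

## What
The lead's twist-unit road (`…LeafRankOneUpperAtThreeTwistUnit`, rhp-p2 g7, p630223) proves U₁ at a Tamagawa-free leaf curve `W` from SEVEN printed
facts and the SPLIT twist-unit datum `SchneiderFree.Upper.TwistUnitFieldAt W 3` (§3 `leafRankOneUpper_three_tamFree_of_print_of_twistUnit`: no S2,
no Σ, no L₀, no image hypothesis). This file supplies the datum and the instances:
* §0 two DOORS `twistUnitFieldAt_of_sqrtField` (`D ≡ 1 (mod 8)`) / `twistUnitFieldAt_of_sqrtField_of_odd` (odd level, `D ≡ 1 (mod 4)`): at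
  `K = ℚ(√D)` (`D < 0` squarefree, `(D/ℓ) = 1` at the odd `ℓ ∣ N`) the datum at `(W, p)` follows from `L(W^{(D)},1) ≠ 0` and ONE globally minimal
  model `Wd` of `W^{(D)}` (`Cd • W^{(D)} = Wd`) whose `#Ш_an` is a rational of `ord_p ≤ 0` — the member is `W` itself (`IsIsogenous.refl`); KERNEL:
  `IsImaginaryQuadratic`, `d_K = D` odd, the Heegner hypothesis (`satisfiesHeegnerHypothesis_sqrtField{_of_odd}`).
* §1–§10 per curve `E` of `133956n1, 169848k1, 205128l2, 182853c1, 250065g1, 228897c1, 355338h1, 409248cy1, 439794p1, 205128l1` (the ten curves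
  of the nine+one intrinsic rank-one Gss2 classes, `#Ш(E)_an = 9`; §1–§2 in this file, §3–§5 / §6–§8 / §9–§10 in parts `…IntrinsicB` / `C` / `D`): `tu_at_<label> : … → Upper.TwistUnitFieldAt W 3` with KERNEL field / Heegner
  hypothesis / twist identity / Kraus minimality of `Wd` (g9 `…StepLIntrinsic*` and k1 `…Gss2Records*` theorems BY NAME) and DISPLAYED `hN`
  (Cremona's conductor), `hLt` (`L(E^{(D)},1) ≠ 0`, PARI `ellL1` = `lfun`), `hqd`/`hvd` (`#Ш(Wd)_an = 1`); and, at the nine TAMAGAWA-FREE curves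
  (all but `133956n1`, whose `c₂ = 3` at an additive prime closes §3 and §4 of the road), `u1_at_<label> : … → MissingUpperBoundAt W 3` by §3 with
  `∏ c_ℓ(E)` IN THE KERNEL (Tate certificates: k1 `tamagawaProduct_g<label>` by name for seven, NEW n1011-p03 `tamcert.py` rows for `169848k1`,
  `205128l2`), `¬ CM` in the kernel, `Addv ∧ SubGss` at `3` in the kernel (`subGss_three_<label>` / `subGss_g<label>_3`), and DISPLAYED `hr`
  (`r_an = 1`), the parametrisation datum `Dt` with `3 ∤ c(Dt)` (Manin; `c = 1` for these optimal curves, Cremona), plus the seven PRINTED facts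
  of §3 as hypotheses; finally `bsd3_at_<label> : … → BSDp W 3` pairing `u1_at_<label>` with g8's LOWER half `RamifiedHeegnerPairL1Intrinsic.lowerHalf_three_<label>`
  (displayed `#Ш(E)_an = q`, `ord₃ q ≤ 2`, and the rigorous 3-descent certificate `27 ∣ #Sel₃(E)` of kit j300939/j302517) through
  `Typed.bsdp_of_missingPPartAt`.
Compared with the k1 records `…HeegnerKolyvagin.bsdp_g<label>_3` (seven of these curves) the upper half here spends NO Kolyvagin-1990 image-exact
bound, NO Selmer subgroup and NO Manin fact beyond the displayed `3 ∤ c(Dt)`: Matar–Nekovář 2019 Thm 0.7 (irreducible form) + the twist-unit field.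

## Data
Per curve `D` = the least negative fundamental discriminant `≡ 1 (mod 8)` split at every odd `ℓ ∣ N` with `L(E^{(D)},1) ≠ 0` and `3 ∤ #Ш(E^{(D)})_an`
(g9 kit j304074/j304302; re-confirmed by the g11 TU census kit job, `TU1-CENSUS.tsv` on the seat's desk `pub/bsd-wall/bsd-trib-w-rhp/g11/`, where the
same datum is tabulated for all 355 rank-one Gss2 classes). [cite: GrossZagier1986, Thm. I.(6.3) and (7.3)] [cite: MatarNekovar2019, Thm. 0.7 (p. 456)]
[cite: KrizLi2019, Thm. 1.20] [cite: Silverman1994, IV.9.4] [cite: Tate1975, §7] [cite: Cremona2006, Table 1] [cite: SilvermanAEC2009, C.11 (CM j-invariants)]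
-/

set_option linter.dupNamespace false
set_option autoImplicit false

noncomputable section

open scoped Classical NumberField

open WeierstrassCurve NumberField IsDedekindDomain IsDedekindDomain.HeightOneSpectrum Rat.HeightOneSpectrum Field
  Literature Literature.NumberTheory.DiophantineGeometry Literature.NumberTheory.EllipticCurves
  Literature.NumberTheory.EllipticCurves.ModularForms Literature.NumberTheory.EllipticCurves.Rank1Residual
  Literature.NumberTheory.EllipticCurves.Rank1Residual.Typed Literature.NumberTheory.Automorphic
  Literature.NumberTheory.EllipticCurves.Rank1Residual.X11RankOneCertificates
  Literature.NumberTheory.EllipticCurves.KrizLi2019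
  Literature.NumberTheory.GaloisRepresentations Literature.NumberTheory.QuadraticFields
  Summit.BirchSwinnertonDyer.BirchSwinnertonDyer.Rank1Residual.IntModel
  Summit.BirchSwinnertonDyer.BirchSwinnertonDyer.Rank2Observatory.Tam
  Summit.BirchSwinnertonDyer.Rank1Residual Summit.BirchSwinnertonDyer.Rank1Residual.Additive
  Summit.BirchSwinnertonDyer.Rank1Residual.X11b Summit.BirchSwinnertonDyer.Rank1Residual.X11b.Three
  Summit.BirchSwinnertonDyer.Rank1Residual.GaloisImage Summit.BirchSwinnertonDyer.Rank1Residual.Supersingular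
  Summit.BirchSwinnertonDyer.BirchSwinnertonDyer.Theses.RamifiedHeegnerPair
  Summit.BirchSwinnertonDyer.BirchSwinnertonDyer.Theorems
  Summit.BirchSwinnertonDyer.BirchSwinnertonDyer.Theorems.SchneiderFree
  Summit.BirchSwinnertonDyer.BirchSwinnertonDyer.Theorems.RamifiedPairUpperBound
  Summit.BirchSwinnertonDyer.BirchSwinnertonDyer.Theorems.RamifiedHeegnerPairStepLIntrinsic
  Summit.BirchSwinnertonDyer.BirchSwinnertonDyer.Theorems.AdditiveBranchIMCGordTwoRankOne.HeegnerKolyvagin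

namespace Summit.BirchSwinnertonDyer.BirchSwinnertonDyer.Theorems.RamifiedHeegnerPairTwistUnitIntrinsic

/-! ## §0 Doors: the split twist-unit datum at `K = ℚ(√D)` -/

/-- **DOOR (even or odd level): the split twist-unit datum at `K = ℚ(√D)`, `D ≡ 1 (mod 8)`.** Data: `D < 0` squarefree with `D ≡ 1 (mod 8)`
and `(D/ℓ) = 1` for every odd prime `ℓ ∣ N` (so every `ℓ ∣ N` splits in `K = sqrtField D` and `d_K = D` is odd), the conductor value `N`
(displayed), `L(W^{(D)},1) ≠ 0`, and ONE globally minimal model `Wd` of the twist (`Cd • W^{(D)} = Wd`) with `#Ш(Wd)_an = qd`, `ord_p qd ≤ 0`.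
The member of the datum is `W` itself (`IsIsogenous.refl`). KERNEL: `isImaginaryQuadratic_and_discr_sqrtField`,
`satisfiesHeegnerHypothesis_sqrtField`. [cite: GrossLMS1991, §1] [cite: KrizLi2019, Thm. 1.20] [cite: Cox2013, §5.B] -/
theorem twistUnitFieldAt_of_sqrtField (W : WeierstrassCurve ℚ) [W.IsElliptic] [W.IsGloballyMinimal] (p : ℕ) [Fact p.Prime]
    (N : ℕ) (D : ℤ) [hD : Fact (D < 0)] (hD8 : D % 8 = 1) (hsfN : Squarefree D.natAbs)
    (hjac : ∀ ℓ : ℕ, ℓ.Prime → ℓ ∣ N → ℓ ≠ 2 → jacobiSym D ℓ = 1)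
    (hN : W.conductorNorm ℤ = N) (hLt : (W.quadraticTwist (D : ℚ)).entireLFunction 1 ≠ 0)
    (Wd : WeierstrassCurve ℚ) [Wd.IsElliptic] [Wd.IsGloballyMinimal] (Cd : VariableChange ℚ)
    (hWd : Cd • W.quadraticTwist (D : ℚ) = Wd) {qd : ℚ} (hqd : shaAn Wd = (qd : ℂ)) (hvd : padicValRat p qd ≤ 0) :
    Upper.TwistUnitFieldAt W p := by
  have hsf : Squarefree D := Int.squarefree_natAbs.mp hsfN
  obtain ⟨hK, hdisc⟩ := isImaginaryQuadratic_and_discr_sqrtField D (by omega) hsf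
  have hHN : SatisfiesHeegnerHypothesis N (sqrtField D) := satisfiesHeegnerHypothesis_sqrtField D hD8 hsf hjac
  have hodd : Odd (NumberField.discr (sqrtField D)) := by rw [hdisc, Int.odd_iff]; omega
  refine ⟨sqrtField D, inferInstance, inferInstance, W, Wd, ‹_›, ‹_›, ‹_›, ‹_›, hK, hodd, ?_, ?_, IsIsogenous.refl_holds W,
    ⟨Cd, ?_⟩, qd, hqd, hvd⟩
  · rw [hN]; exact hHN
  · rw [hdisc]; exact hLt
  · rw [hdisc]; exact hWd

/-- **DOOR (odd level): the split twist-unit datum at `K = ℚ(√D)`, `D ≡ 1 (mod 4)`, `2 ∤ N`.** As `twistUnitFieldAt_of_sqrtField` with the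
prime `2` absent from the level, so `D ≡ 5 (mod 8)` (2 inert) is allowed: `(D/ℓ) = 1` for every prime `ℓ ∣ N`
(`satisfiesHeegnerHypothesis_sqrtField_of_odd`). [cite: GrossLMS1991, §1] [cite: KrizLi2019, Thm. 1.20] [cite: Cox2013, §5.B] -/
theorem twistUnitFieldAt_of_sqrtField_of_odd (W : WeierstrassCurve ℚ) [W.IsElliptic] [W.IsGloballyMinimal] (p : ℕ) [Fact p.Prime]
    (N : ℕ) (D : ℤ) [hD : Fact (D < 0)] (hD4 : D % 4 = 1) (hsfN : Squarefree D.natAbs) (hN2 : ¬ 2 ∣ N)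
    (hjac : ∀ ℓ : ℕ, ℓ.Prime → ℓ ∣ N → jacobiSym D ℓ = 1)
    (hN : W.conductorNorm ℤ = N) (hLt : (W.quadraticTwist (D : ℚ)).entireLFunction 1 ≠ 0)
    (Wd : WeierstrassCurve ℚ) [Wd.IsElliptic] [Wd.IsGloballyMinimal] (Cd : VariableChange ℚ)
    (hWd : Cd • W.quadraticTwist (D : ℚ) = Wd) {qd : ℚ} (hqd : shaAn Wd = (qd : ℂ)) (hvd : padicValRat p qd ≤ 0) :
    Upper.TwistUnitFieldAt W p := by
  have hsf : Squarefree D := Int.squarefree_natAbs.mp hsfN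
  obtain ⟨hK, hdisc⟩ := isImaginaryQuadratic_and_discr_sqrtField D hD4 hsf
  have hHN : SatisfiesHeegnerHypothesis N (sqrtField D) := satisfiesHeegnerHypothesis_sqrtField_of_odd D hD4 hsf hN2 hjac
  have hodd : Odd (NumberField.discr (sqrtField D)) := by rw [hdisc, Int.odd_iff]; omega
  refine ⟨sqrtField D, inferInstance, inferInstance, W, Wd, ‹_›, ‹_›, ‹_›, ‹_›, hK, hodd, ?_, ?_, IsIsogenous.refl_holds W,
    ⟨Cd, ?_⟩, qd, hqd, hvd⟩
  · rw [hN]; exact hHN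
  · rw [hdisc]; exact hLt
  · rw [hdisc]; exact hWd


/-! ## §1 `133956n1` = `[0, 0, 0, 33489, -36770922]`, `N = 133956 = 2^2·3^2·61^2`, `K = ℚ(√-47)`, `Wd = [0, 0, 0, 73977201, 3817667434806]` (`N(Wd) = 295908804`, `∏c(Wd) = 48`, `#Wd(ℚ)_tors = 1`, `#Ш(Wd)_an = 1`; `L(E^{(-47)},1) = 1.5645411526`) -/

/-- **THE TWIST-UNIT DATUM AT `133956n1` over `K = ℚ(√-47)`** — `SchneiderFree.Upper.TwistUnitFieldAt W 3` at `W = E`, member `W₂ = E`. KERNEL: the field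
(`sqrtField (-47)`, imaginary quadratic, `d_K = -47` odd), the Heegner hypothesis at `N = 133956` (`-47 ≡ 1 (mod 8)`, `(-47/ℓ) = 1` at the odd `ℓ ∣ N`),
Kraus minimality of `Wd` (`isGloballyMinimal_sWd133956n1`, by name), the twist identity `Cd • E^{(-47)} = Wd` with `Cd = [1, 0, 0, 0]`. DISPLAYED: Cremona's
`N(E) = 133956` (`hN`), `L(E^{(-47)},1) = 1.5645411526 ≠ 0` (`hLt`, PARI `ellL1` = `lfun`), `#Ш(Wd)_an = 1` (`hqd`/`hvd`; g9 kit j304074, g11 TU census).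
A per-curve certificate of the research statement TU₁; nothing booked; BSD is not proved by this. [cite: KrizLi2019, Thm. 1.20]
[cite: GrossZagier1986, Thm. I.(6.3)] [cite: Cremona2006, Table 1 (Cremona label 133956n1)] -/
theorem tu_at_133956n1 {W : WeierstrassCurve ℚ} [W.IsElliptic] [W.IsGloballyMinimal] (hWeq : W = (⟨0, 0, 0, 33489, -36770922⟩ : WeierstrassCurve ℚ))
    (hN : W.conductorNorm ℤ = 133956) (hLt : (W.quadraticTwist ((-47 : ℤ) : ℚ)).entireLFunction 1 ≠ 0)
    {qd : ℚ} (hqd : haveI := isElliptic_sWd133956n1; shaAn (⟨0, 0, 0, 73977201, 3817667434806⟩ : WeierstrassCurve ℚ) = (qd : ℂ)) (hvd : padicValRat 3 qd ≤ 0) :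
    Upper.TwistUnitFieldAt W 3 := by
  subst hWeq
  haveI := isElliptic_sWd133956n1; haveI := isGloballyMinimal_sWd133956n1
  haveI : Fact ((-47 : ℤ) < 0) := ⟨by norm_num⟩
  have hjac : ∀ ℓ : ℕ, ℓ.Prime → ℓ ∣ 133956 → ℓ ≠ 2 → jacobiSym (-47) ℓ = 1 := by
    intro ℓ hℓ hℓN hℓ2
    have hmem : ℓ ∈ Nat.primeFactors 133956 := Nat.mem_primeFactors.mpr ⟨hℓ, hℓN, by norm_num⟩
    have hpf : Nat.primeFactors 133956 = {2, 3, 61} := by decide +kernel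
    rw [hpf] at hmem
    simp only [Finset.mem_insert, Finset.mem_singleton] at hmem
    rcases hmem with rfl | rfl | rfl
    · exact absurd rfl hℓ2
    all_goals norm_num
  have hWd : (⟨1, (0 : ℚ), (0 : ℚ), (0 : ℚ)⟩ : VariableChange ℚ) •
      (⟨0, 0, 0, 33489, -36770922⟩ : WeierstrassCurve ℚ).quadraticTwist ((-47 : ℤ) : ℚ) = (⟨0, 0, 0, 73977201, 3817667434806⟩ : WeierstrassCurve ℚ) := by
    push_cast
    ext <;> simp [WeierstrassCurve.variableChange_a₁, WeierstrassCurve.variableChange_a₂,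
      WeierstrassCurve.variableChange_a₃, WeierstrassCurve.variableChange_a₄, WeierstrassCurve.variableChange_a₆,
      WeierstrassCurve.quadraticTwist, WeierstrassCurve.b₂, WeierstrassCurve.b₄, WeierstrassCurve.b₆] <;> norm_num
  exact twistUnitFieldAt_of_sqrtField _ 3 133956 (-47) (by norm_num)
    (by rw [show (-47 : ℤ).natAbs = 47 by rfl, Nat.squarefree_iff_nodup_primeFactorsList (by norm_num)]; simp)
    hjac hN hLt _ _ hWd hqd hvd

/- `133956n1`: `∏ c_ℓ = 24` with `c₂ = 3` at the ADDITIVE prime `2` (`IV*`) and no multiplicative prime (`N = 2²·3²·61²`): neither the Tamagawa-free §3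
nor the mono-carrier §4 of the twist-unit road applies; U₁ here needs §5/§6 (S2 + Σ★″). Only the datum `tu_at_133956n1` is recorded. -/

/-! ## §2 `169848k1` = `[0, 0, 0, -1757979, -897161130]`, `N = 169848 = 2^3·3^2·7·337`, `K = ℚ(√-47)`, `Wd = [0, 0, 0, -3883375611, 93145959999990]` (`N(Wd) = 375194232`, `∏c(Wd) = 4`, `#Wd(ℚ)_tors = 1`, `#Ш(Wd)_an = 1`; `L(E^{(-47)},1) = 0.2331432023`) -/

/-- **THE TWIST-UNIT DATUM AT `169848k1` over `K = ℚ(√-47)`** — `SchneiderFree.Upper.TwistUnitFieldAt W 3` at `W = E`, member `W₂ = E`. KERNEL: the field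
(`sqrtField (-47)`, imaginary quadratic, `d_K = -47` odd), the Heegner hypothesis at `N = 169848` (`-47 ≡ 1 (mod 8)`, `(-47/ℓ) = 1` at the odd `ℓ ∣ N`),
Kraus minimality of `Wd` (`isGloballyMinimal_sWd169848k1`, by name), the twist identity `Cd • E^{(-47)} = Wd` with `Cd = [1, 0, 0, 0]`. DISPLAYED: Cremona's
`N(E) = 169848` (`hN`), `L(E^{(-47)},1) = 0.2331432023 ≠ 0` (`hLt`, PARI `ellL1` = `lfun`), `#Ш(Wd)_an = 1` (`hqd`/`hvd`; g9 kit j304074, g11 TU census).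
A per-curve certificate of the research statement TU₁; nothing booked; BSD is not proved by this. [cite: KrizLi2019, Thm. 1.20]
[cite: GrossZagier1986, Thm. I.(6.3)] [cite: Cremona2006, Table 1 (Cremona label 169848k1)] -/
theorem tu_at_169848k1 {W : WeierstrassCurve ℚ} [W.IsElliptic] [W.IsGloballyMinimal] (hWeq : W = (⟨0, 0, 0, -1757979, -897161130⟩ : WeierstrassCurve ℚ))
    (hN : W.conductorNorm ℤ = 169848) (hLt : (W.quadraticTwist ((-47 : ℤ) : ℚ)).entireLFunction 1 ≠ 0)
    {qd : ℚ} (hqd : haveI := isElliptic_sWd169848k1; shaAn (⟨0, 0, 0, -3883375611, 93145959999990⟩ : WeierstrassCurve ℚ) = (qd : ℂ)) (hvd : padicValRat 3 qd ≤ 0) :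
    Upper.TwistUnitFieldAt W 3 := by
  subst hWeq
  haveI := isElliptic_sWd169848k1; haveI := isGloballyMinimal_sWd169848k1
  haveI : Fact ((-47 : ℤ) < 0) := ⟨by norm_num⟩
  have hjac : ∀ ℓ : ℕ, ℓ.Prime → ℓ ∣ 169848 → ℓ ≠ 2 → jacobiSym (-47) ℓ = 1 := by
    intro ℓ hℓ hℓN hℓ2
    have hmem : ℓ ∈ Nat.primeFactors 169848 := Nat.mem_primeFactors.mpr ⟨hℓ, hℓN, by norm_num⟩
    have hpf : Nat.primeFactors 169848 = {2, 3, 7, 337} := by decide +kernel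
    rw [hpf] at hmem
    simp only [Finset.mem_insert, Finset.mem_singleton] at hmem
    rcases hmem with rfl | rfl | rfl | rfl
    · exact absurd rfl hℓ2
    all_goals norm_num
  have hWd : (⟨1, (0 : ℚ), (0 : ℚ), (0 : ℚ)⟩ : VariableChange ℚ) •
      (⟨0, 0, 0, -1757979, -897161130⟩ : WeierstrassCurve ℚ).quadraticTwist ((-47 : ℤ) : ℚ) = (⟨0, 0, 0, -3883375611, 93145959999990⟩ : WeierstrassCurve ℚ) := by
    push_cast
    ext <;> simp [WeierstrassCurve.variableChange_a₁, WeierstrassCurve.variableChange_a₂,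
      WeierstrassCurve.variableChange_a₃, WeierstrassCurve.variableChange_a₄, WeierstrassCurve.variableChange_a₆,
      WeierstrassCurve.quadraticTwist, WeierstrassCurve.b₂, WeierstrassCurve.b₄, WeierstrassCurve.b₆] <;> norm_num
  exact twistUnitFieldAt_of_sqrtField _ 3 169848 (-47) (by norm_num)
    (by rw [show (-47 : ℤ).natAbs = 47 by rfl, Nat.squarefree_iff_nodup_primeFactorsList (by norm_num)]; simp)
    hjac hN hLt _ _ hWd hqd hvd

/-- Row certificate of `169848k1 = [0, 0, 0, -1757979, -897161130]` (stage-1 `TamLocal` at every bad prime — `2`: II*, `c = 1`; `3`: I0*, `c = 1`; `7`: In, `c = 2`; `337`: In, `c = 1` — and the stage-3 `TamZ` entry making the `I₀*` prime `3`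
exact): checks in the kernel. Emitted by n1011-p03 `tools/tamcert.py` = rank-2 observatory engine 1, unchanged. [cite: Silverman1994, IV.9.4 Steps 2–7]
[cite: Tate1975, §7] [cite: Cremona2006, Table 1 (Cremona label 169848k1)] -/
theorem tamRowZ_169848k1 :
    TamZ.rowCheckZ [⟨2, 1, 5, 0, 3, 1, 8, 11, 10, 0, 1⟩, ⟨3, 1, 5, 0, 0, 0, 0, 6, 6, 0, 1⟩, ⟨7, 2, 3, 0, 0, 0, 0, 8, 0, 0, 2⟩, ⟨337, 18, 3, 0, 0, 0, 0, 1, 0, 0, 1⟩] [] [⟨3, 9, 0, 0, 0, 6, 0, 0⟩] (⟨0, 0, 0, -1757979, -897161130⟩ : WeierstrassCurve ℤ) = true := by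
  decide +kernel

/-- **`∏_ℓ c_ℓ(169848k1) = 2` IN THE KERNEL** for any globally minimal `W / ℚ` with this integral model (Cremona's column: `2`; so `3 ∤ ∏ c_ℓ`).
[cite: Silverman1994, IV.9.4] [cite: Cremona2006, Table 1 (Cremona label 169848k1)] -/
theorem tamagawaProduct_169848k1 {W : WeierstrassCurve ℚ} [W.IsGloballyMinimal]
    (hI : integralModelInt W = (⟨0, 0, 0, -1757979, -897161130⟩ : WeierstrassCurve ℤ)) : W.tamagawaProduct = 2 :=
  (IntModelTam.tamagawaProduct_eq_rowValueZ_of_intModel hI tamRowZ_169848k1 (by decide +kernel)).trans (by decide +kernel)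

/-- **U₁ AT `169848k1` BY THE TWIST-UNIT ROAD** — `MissingUpperBoundAt W 3` (`ord₃ #Ш(E) ≤ ord₃ #Ш(E)_an`) at `W = E` from rhp-p2 g7 §3
`leafRankOneUpper_three_tamFree_of_print_of_twistUnit`: PRINTED binders `hGZ hKo hGZK hmod hGZ73 hMN hCassels` (Gross–Zagier ∀, Kolyvagin ∀, GZK,
Version L, GZ I.(7.3), Matar–Nekovář 2019 Thm 0.7 irreducible form, Cassels); KERNEL: `∏ c_ℓ(E) = 2` (NEW Tate certificate `tamagawaProduct_169848k1`), `¬ CM` (`j = c₄³/Δ` is none of the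
thirteen CM `j`-invariants, `hasCM_iff_j_mem_holds` + `norm_num`), `Addv ∧ SubGss` at `3` (`subGss_three_169848k1`), and everything kernel in `tu_at_169848k1`; DISPLAYED: `hN`, `hr` (`r_an(E) = 1`, Cremona),
the parametrisation datum `Dt` at level `N_E` with `3 ∤ c(Dt)` (`hc`; Manin constant `1` for this optimal curve, Cremona `manin.txt`), `hLt`, `hqd`/`hvd`.
NO S2, NO Σ, NO L₀, NO image hypothesis. Per curve; U₁ (26022) stays OPEN; BSD is not proved by this.
[cite: MatarNekovar2019, Thm. 0.7 (p. 456) and §0.11 (p. 457)] [cite: GrossZagier1986, Thm. I.(6.3) and (7.3)] [cite: Miller2011LMS, Def. 1.1]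
[cite: Cremona2006, Table 1 (Cremona label 169848k1)] -/
theorem u1_at_169848k1
    (hGZ : ∀ (N : ℕ) [NeZero N] (W : WeierstrassCurve ℚ) (K : Type) [Field K] [NumberField K], gross_zagier N W K)
    (hKo : ∀ (N : ℕ) [NeZero N] (W : WeierstrassCurve ℚ) (K : Type) [Field K] [NumberField K], kolyvagin N W K)
    (hGZK : rank_eq_analyticRank_of_analyticRank_le_one) (hmod : hasEntireLFunction_rat)
    (hGZ73 : GrossZagier1986_thm_I_7_3)
    (hMN : MatarNekovar2019.thm07_padicValNat_card_sha_primary_add_le_of_globalDivisibility_of_irreducible)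
    (hCassels : bsdRHS_eq_of_isIsogenous)
    {W : WeierstrassCurve ℚ} [W.IsElliptic] [W.IsGloballyMinimal] (hWeq : W = (⟨0, 0, 0, -1757979, -897161130⟩ : WeierstrassCurve ℚ))
    (hN : W.conductorNorm ℤ = 169848) [NeZero (W.conductorNorm ℤ)] (hr : W.analyticRank = 1)
    (Dt : ModularParametrizationData W (W.conductorNorm ℤ)) (hc : ¬ (3 : ℤ) ∣ Dt.c)
    (hLt : (W.quadraticTwist ((-47 : ℤ) : ℚ)).entireLFunction 1 ≠ 0)
    {qd : ℚ} (hqd : haveI := isElliptic_sWd169848k1; shaAn (⟨0, 0, 0, -3883375611, 93145959999990⟩ : WeierstrassCurve ℚ) = (qd : ℂ)) (hvd : padicValRat 3 qd ≤ 0) :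
    MissingUpperBoundAt W 3 := by
  have hTU : Upper.TwistUnitFieldAt W 3 := tu_at_169848k1 hWeq hN hLt hqd hvd
  subst hWeq
  have hI : integralModelInt (⟨0, 0, 0, -1757979, -897161130⟩ : WeierstrassCurve ℚ) = (⟨0, 0, 0, -1757979, -897161130⟩ : WeierstrassCurve ℤ) :=
    integralModelInt_eq_of_map_eq _ (map_mk_int 0 0 0 (-1757979) (-897161130))
  have htam : ¬ 3 ∣ (⟨0, 0, 0, -1757979, -897161130⟩ : WeierstrassCurve ℚ).tamagawaProduct := by rw [tamagawaProduct_169848k1 hI]; norm_num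
  have hCM : ¬ (⟨0, 0, 0, -1757979, -897161130⟩ : WeierstrassCurve ℚ).HasCM := fun hCM ↦ by
    have hj := (WeierstrassCurve.hasCM_iff_j_mem_holds (⟨0, 0, 0, -1757979, -897161130⟩ : WeierstrassCurve ℚ)).1 hCM
    rw [WeierstrassCurve.j, Units.val_inv_eq_inv_val, WeierstrassCurve.coe_Δ'] at hj
    simp only [cmJInvariants, Finset.mem_insert, Finset.mem_singleton] at hj
    norm_num [WeierstrassCurve.Δ, WeierstrassCurve.b₂, WeierstrassCurve.b₄, WeierstrassCurve.b₆, WeierstrassCurve.b₈,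
      WeierstrassCurve.c₄] at hj
  exact leafRankOneUpper_three_tamFree_of_print_of_twistUnit hGZ hKo hGZK hmod hGZ73 hMN hCassels _ hCM subGss_three_169848k1.1 subGss_three_169848k1.2
    hr htam Dt hc hTU

/-- **BSD₃ AT `169848k1` modulo print and displayed numerics, by the twist-unit road** — `BSDp W 3` from `u1_at_169848k1` (upper half) and g8's LOWER half
`RamifiedHeegnerPairL1Intrinsic.lowerHalf_three_169848k1` (`9 ∣ #Ш(E)` by the rigorous 3-descent certificate `27 ∣ #Sel₃(E)`, displayed as `hSel`, with
`#Ш(E)_an = q`, `ord₃ q ≤ 2` displayed), glued by `Typed.missingPPartAt_of_lower_of_upper` + `Typed.bsdp_of_missingPPartAt` (GZK). Per curve, CONDITIONAL on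
every displayed input and the seven printed facts; nothing booked; BSD is not proved by this. [cite: Miller2011LMS, Def. 1.1] [cite: SchaeferStoll2004, Cor. 5.9]
[cite: MatarNekovar2019, Thm. 0.7 (p. 456)] [cite: Cremona2006, Table 1 (Cremona label 169848k1)] -/
theorem bsd3_at_169848k1
    (hGZ : ∀ (N : ℕ) [NeZero N] (W : WeierstrassCurve ℚ) (K : Type) [Field K] [NumberField K], gross_zagier N W K)
    (hKo : ∀ (N : ℕ) [NeZero N] (W : WeierstrassCurve ℚ) (K : Type) [Field K] [NumberField K], kolyvagin N W K)
    (hGZK : rank_eq_analyticRank_of_analyticRank_le_one) (hmod : hasEntireLFunction_rat)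
    (hGZ73 : GrossZagier1986_thm_I_7_3)
    (hMN : MatarNekovar2019.thm07_padicValNat_card_sha_primary_add_le_of_globalDivisibility_of_irreducible)
    (hCassels : bsdRHS_eq_of_isIsogenous)
    {W : WeierstrassCurve ℚ} [W.IsElliptic] [W.IsGloballyMinimal] (hWeq : W = (⟨0, 0, 0, -1757979, -897161130⟩ : WeierstrassCurve ℚ))
    (hN : W.conductorNorm ℤ = 169848) [NeZero (W.conductorNorm ℤ)] (hr : W.analyticRank = 1)
    {q : ℚ} (hq : shaAn W = (q : ℂ)) (hv : padicValRat 3 q ≤ 2) (hSel : 3 ^ 3 ∣ Nat.card (W.selmerGroup 3))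
    (Dt : ModularParametrizationData W (W.conductorNorm ℤ)) (hc : ¬ (3 : ℤ) ∣ Dt.c)
    (hLt : (W.quadraticTwist ((-47 : ℤ) : ℚ)).entireLFunction 1 ≠ 0)
    {qd : ℚ} (hqd : haveI := isElliptic_sWd169848k1; shaAn (⟨0, 0, 0, -3883375611, 93145959999990⟩ : WeierstrassCurve ℚ) = (qd : ℂ)) (hvd : padicValRat 3 qd ≤ 0) :
    BSDp W 3 := by
  have hup : MissingUpperBoundAt W 3 := u1_at_169848k1 hGZ hKo hGZK hmod hGZ73 hMN hCassels hWeq hN hr Dt hc hLt hqd hvd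
  subst hWeq
  have hlow : MissingLowerBoundAt (⟨0, 0, 0, -1757979, -897161130⟩ : WeierstrassCurve ℚ) 3 :=
    RamifiedHeegnerPairL1Intrinsic.lowerHalf_three_169848k1 hGZK hr hq hv hSel
  exact Typed.bsdp_of_missingPPartAt _ 3 hGZK hr.le (Typed.missingPPartAt_of_lower_of_upper _ 3 hlow hup)

end Summit.BirchSwinnertonDyer.BirchSwinnertonDyer.Theorems.RamifiedHeegnerPairTwistUnitIntrinsic

end
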